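import Summits.CriticalPhenomena.PercolationContinuityZ3.Theorems.PercNearOneGluingNoHeavyLowerTailSimexFreeRelay
import Summits.CriticalPhenomena.PercolationContinuityZ3.Theorems.PercNearOneGluingAdditiveGluingSetObserverLemma3
import Summits.CriticalPhenomena.PercolationContinuityZ3.Theorems.PercNearOneGluingAdditiveGluingBlockGrowth
import HarnessLib

/-!
# `NoHeavyLowerTail` (stmt-CriticalPhenomena-4575): the GAP CERTIFICATE for SIMEX / the D-cone (any number of relays)

Support file (`--supports stmt-CriticalPhenomena-4575`), route task `nh-dp-commonrelay`, gen 2.  No definitions, no named facts.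

Setting: weighting `u` on the pairs of `Fin n`, relays `A ∋ b`, designated relay `a₀`, competitors `A' = A ∖ {a₀,b}`, block `S`
with un-glued cluster `K_S = ⋃_{v∈S} C(v)`, capture event `CAP = {K_S ∩ A' ≠ ∅, a₀ ∉ K_S}`, and for a competitor `c` the trap
excess `Δ_c = μ((c↔b) ∩ CAP ∩ (S↮c)) − μ((S↔b) ∩ CAP ∩ (S↮c))` ("by how much the free relay `c` beats the block").

* `SandwichSet.lemma3_sandwich_set_gap` — Kozma–Nitzan's Lemma 3 for a set observer WITH THE RELIABILITY GAP KEPT: for a sandwich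
  family `Q` of the pair `(a₁, a₂)` and `D = {a₁ ↮ a₂}`:  `μ(Q ∩ D)·(μ(a₂↔b) − μ(a₁↔b)) ≤ μ(D)·(μ({a₂↔b} ∩ Q) − μ({a₁↔b} ∩ Q))`.
  No order between the relays is assumed (the landed `lemma3_sandwich_set` is the sign consequence); same BHK proof, stopped one
  step before the relay hypothesis is spent.
* `simexU_of_gapCertificate` — SIMEX (un-glued form, `μ((a₀↔b) ∩ CAP) ≤ μ((S↔b) ∩ CAP)`) holds as soon as SOME competitor
  `c ∈ A'` with `μ(a₀ ↮ c) > 0` satisfies the **gap certificate**  `Δ_c · μ(a₀ ↮ c) ≤ (μ(c↔b) − μ(a₀↔b)) · μ(CAP ∩ {a₀ ↮ c})`: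
  the trap excess of one free competitor is paid by its reliability gap over `a₀`.  (`Δ_c ≤ 0 ≤ μ(c↔b) − μ(a₀↔b)` is the special
  case "free-relay certificate".)  Proof: the gap lemma with the whole capture event as sandwich family, then split `{c↔b} ∩ CAP`
  along `c ∈ K_S`.
* `simex_of_gapCertificate` / `dKernel_of_gapCertificate` — the glued instance (`stub_simex`) and the D-cone instance (`stub_dcone`,
  block form of KN (41) against `a₀`), by un-gluing (`simex_glue_lhs/rhs` of `…SimexFreeRelay.lean`) and `dKernel_of_simex_instance`.
  The sign-only special case is the landed free-relay certificate `simexU_of_freeRelay`.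
Census (this seat, exact enumeration, `n ≤ 7`, `|A'| ≤ 4`, 3 431 random weightings): the gap certificate holds for some competitor
in EVERY sample (the sign-only free-relay certificate fails in 1–3 %).  It can only fail in the ALL-TRAP regime (`Δ_c > 0` for all
`c`) at a near FULL TIE of the competitors with `a₀` (right side small) — exactly the locus where adversarial search finds the D-cone
tight.  So the residual of `stub_simex` / `stub_dcone` (= KN Question 9) is the full-tie all-trap corner, for any number of relays.
[cite: KozmaNitzan2024, Lemma 3 (pp. 6–7), Question 9 (p. 36); VandenbergHaggstromKahn2006, Thms 1.3–1.5]
-/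

noncomputable section

open MeasureTheory unitInterval
open Literature.Probability.LatticeModels (prodBernoulli)
open Literature.Probability.Percolation
open Literature.Probability.Percolation.BHK2006

namespace Summit.CriticalPhenomena.PercolationContinuityZ3.Theorems

namespace SandwichSet

variable {V : Type*} [Fintype V]

open scoped Classical in
/-- **Quantitative sandwich exchange (Kozma–Nitzan Lemma 3 for a set observer, with the reliability gap kept).**
For a sandwich family `𝓕` of the pair `(a₁, a₂)` (`{a₂ ∈ K_O ∌ a₁} ⊆ {K_O ∈ 𝓕} ⊆ {a₁ ∉ K_O}`), `Q = {K_O ∈ 𝓕}` and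
`D = {a₁ ↮ a₂}`:  `μ(D) · (μ({a₂↔b} ∩ Q) − μ({a₁↔b} ∩ Q)) ≥ μ(Q ∩ D) · (μ(a₂↔b) − μ(a₁↔b))`.  NO order between the two
relays is assumed; with `μ(a₁↔b) ≤ μ(a₂↔b)` it gives back `lemma3_sandwich_set`.  Same proof (the two conditional-association
inequalities of van den Berg–Häggström–Kahn on `D`), stopping one step before the relay hypothesis is spent.
[cite: KozmaNitzan2024, Lemma 3 (pp. 6–7); VandenbergHaggstromKahn2006, Thms. 1.3–1.5] -/
theorem lemma3_sandwich_set_gap (w : Sym2 V → unitInterval) (a₁ a₂ b : V) (O : Finset V) (𝓕 : Set (Set V))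
    (hlo : ∀ ω : BondConfig V, a₂ ∈ (⋃ o ∈ O, openCluster ω o) → a₁ ∉ (⋃ o ∈ O, openCluster ω o) →
      (⋃ o ∈ O, openCluster ω o) ∈ 𝓕)
    (hhi : ∀ ω : BondConfig V, (⋃ o ∈ O, openCluster ω o) ∈ 𝓕 → a₁ ∉ (⋃ o ∈ O, openCluster ω o)) :
    (prodBernoulli w).real ({ω | (⋃ o ∈ O, openCluster ω o) ∈ 𝓕} ∩ (openConn a₁ a₂)ᶜ) *
        ((prodBernoulli w).real (openConn a₂ b) - (prodBernoulli w).real (openConn a₁ b)) ≤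
      (prodBernoulli w).real (openConn a₁ a₂ : Set (BondConfig V))ᶜ *
        ((prodBernoulli w).real (openConn a₂ b ∩ {ω | (⋃ o ∈ O, openCluster ω o) ∈ 𝓕}) -
          (prodBernoulli w).real (openConn a₁ b ∩ {ω | (⋃ o ∈ O, openCluster ω o) ∈ 𝓕})) := by
  set μ := prodBernoulli w with hμ
  set Q : Set (BondConfig V) := {ω | (⋃ o ∈ O, openCluster ω o) ∈ 𝓕} with hQ
  set D : Set (BondConfig V) := (openConn a₁ a₂)ᶜ with hD
  have hms : ∀ s : Set (BondConfig V), MeasurableSet s := fun s => (Set.toFinite s).measurableSet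
  set h : Set (Sym2 V) → ℝ := fun C => if {v | ∃ o ∈ O, v = o ∨ ∃ e ∈ C, v ∈ e} ∈ 𝓕 then 1 else 0 with hh
  have h0 : ∀ C, 0 ≤ h C := fun C => by simp only [hh]; split_ifs <;> norm_num
  have h1 : ∀ C, h C ≤ 1 := fun C => by simp only [hh]; split_ifs <;> norm_num
  have hhQ : ∀ ω, h (⋃ o ∈ O, openEdgeCluster ω o) = Q.indicator 1 ω := fun ω => by
    simp only [hh, vertices_of_kUnion]
    by_cases hω : ω ∈ Q
    · rw [Set.indicator_of_mem hω, Pi.one_apply, if_pos (show (⋃ o ∈ O, openCluster ω o) ∈ 𝓕 from hω)]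
    · rw [Set.indicator_of_notMem hω, if_neg (show (⋃ o ∈ O, openCluster ω o) ∉ 𝓕 from hω)]
  -- the cut sandwich function of `(a₂, a₁)` with `h = 1_𝓕` is `1_Q` (everywhere)
  have hg2 : ∀ ω : BondConfig V,
      (if ∃ o ∈ O, (openGraph ω).Reachable o a₁ then (0 : ℝ)
        else if ∃ o ∈ O, (openGraph ω).Reachable a₂ o then 1 else h (⋃ o ∈ O, openEdgeCluster ω o)) =
        Q.indicator 1 ω := by
    intro ω
    by_cases h1K : ∃ o ∈ O, (openGraph ω).Reachable o a₁
    · have hnm : ω ∉ Q := fun hq => hhi ω hq ((mem_kUnion_iff ω O a₁).2 h1K)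
      rw [if_pos h1K, Set.indicator_of_notMem hnm]
    · rw [if_neg h1K]
      by_cases h2K : ∃ o ∈ O, (openGraph ω).Reachable a₂ o
      · have hmem : ω ∈ Q := hlo ω ((mem_kUnion_iff ω O a₂).2 (h2K.imp fun o ⟨ho, hr⟩ => ⟨ho, hr.symm⟩))
          (fun h' => h1K ((mem_kUnion_iff ω O a₁).1 h'))
        rw [if_pos h2K, Set.indicator_of_mem hmem, Pi.one_apply]
      · rw [if_neg h2K, hhQ]
  -- the set sandwich function of `(a₁, a₂)` with `h' = 1 − 1_𝓕` is `1 − 1_Q` (everywhere)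
  have hg1 : ∀ ω : BondConfig V,
      (if ∃ o ∈ O, (openGraph ω).Reachable a₁ o then (1 : ℝ)
        else if ∃ o ∈ O, (openGraph ω).Reachable o a₂ then 0
          else (1 - h (⋃ o ∈ O, openEdgeCluster ω o))) = 1 - Q.indicator 1 ω := by
    intro ω
    by_cases h1K : ∃ o ∈ O, (openGraph ω).Reachable a₁ o
    · have hnm : ω ∉ Q := fun hq => hhi ω hq ((mem_kUnion_iff ω O a₁).2
        (h1K.imp fun o ⟨ho, hr⟩ => ⟨ho, hr.symm⟩))
      rw [if_pos h1K, Set.indicator_of_notMem hnm]; ring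
    · rw [if_neg h1K]
      by_cases h2K : ∃ o ∈ O, (openGraph ω).Reachable o a₂
      · have hmem : ω ∈ Q := hlo ω ((mem_kUnion_iff ω O a₂).2 h2K)
          (fun h' => h1K (((mem_kUnion_iff ω O a₁).1 h').imp fun o ⟨ho, hr⟩ => ⟨ho, hr.symm⟩))
        rw [if_pos h2K, Set.indicator_of_mem hmem, Pi.one_apply]; ring
      · rw [if_neg h2K, hhQ]
  -- the two `D`'s
  have hD2 : {ω : BondConfig V | ¬ (openGraph ω).Reachable a₂ a₁} = D := by
    ext ω
    simp only [hD, Set.mem_setOf_eq, Set.mem_compl_iff]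
    exact ⟨fun h' h'' => h' (show (openGraph ω).Reachable a₁ a₂ from h'').symm,
      fun h' h'' => h' (show ω ∈ openConn a₁ a₂ from h''.symm)⟩
  have hD1 : {ω : BondConfig V | ¬ (openGraph ω).Reachable a₁ a₂} = D := rfl
  have hInd : ∀ S T : Set (BondConfig V),
      ∫ ω in S, T.indicator (1 : BondConfig V → ℝ) ω ∂μ = μ.real (S ∩ T) := by
    intro S T
    rw [← integral_indicator (hms S), Set.indicator_indicator, integral_indicator_one (hms _)]
  have hF : ∀ (a : V) (S : Set (BondConfig V)),
      ∫ ω in S, connIndicatorFn a b (openEdgeCluster ω a) ∂μ = μ.real (S ∩ openConn a b) := by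
    intro a S
    simp_rw [connIndicatorFn_openEdgeCluster]
    exact hInd S _
  have hmul : ∀ (S T : Set (BondConfig V)) (ω : BondConfig V),
      S.indicator (1 : BondConfig V → ℝ) ω * T.indicator 1 ω = (S ∩ T).indicator 1 ω := by
    intro S T ω
    rw [Set.inter_indicator_one, Pi.mul_apply]
  -- Corollary H (cut) for `(s, t) = (a₂, a₁)`, `h = 1_𝓕`
  have hI := sandwich_condAssoc_set_hat w a₂ a₁ O (connIndicatorFn a₂ b) (monotone_connIndicatorFn a₂ b) h h0 h1
  simp_rw [hg2] at hI
  simp_rw [connIndicatorFn_openEdgeCluster, hmul] at hI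
  rw [hInd, hInd, hInd, hD2] at hI
  -- Corollary H for `(s, t) = (a₁, a₂)`, `h' = 1 - 1_𝓕`
  have hJ := sandwich_condAssoc_set w a₁ a₂ O (connIndicatorFn a₁ b) (monotone_connIndicatorFn a₁ b)
    (fun C => 1 - h C) (fun C => sub_nonneg.2 (h1 C)) (fun C => by linarith [h0 C])
  simp_rw [hg1] at hJ
  have hJ' : ∫ ω in {ω : BondConfig V | ¬ (openGraph ω).Reachable a₁ a₂},
      connIndicatorFn a₁ b (openEdgeCluster ω a₁) * (1 - Q.indicator 1 ω) ∂μ =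
      μ.real (D ∩ openConn a₁ b) - μ.real (D ∩ (openConn a₁ b ∩ Q)) := by
    simp_rw [mul_sub, mul_one, connIndicatorFn_openEdgeCluster, hmul]
    rw [integral_sub Integrable.of_finite Integrable.of_finite, hInd, hInd, hD1]
  have hJ'' : ∫ ω in {ω : BondConfig V | ¬ (openGraph ω).Reachable a₁ a₂},
      (1 - Q.indicator 1 ω) ∂μ = μ.real D - μ.real (D ∩ Q) := by
    rw [integral_sub Integrable.of_finite Integrable.of_finite, hInd, hD1]
    have : ∫ ω in D, (1 : ℝ) ∂μ = μ.real D := by rw [setIntegral_const, smul_eq_mul, mul_one]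
    rw [this]
  rw [hJ', hJ'', hF, hD1] at hJ
  -- the gap on `D`, and the common part on `Dᶜ`
  have hτ' : μ.real (D ∩ openConn a₂ b) - μ.real (D ∩ openConn a₁ b) =
      μ.real (openConn a₂ b) - μ.real (openConn a₁ b) := by
    have e := real_inter_openConn_sub_eq μ a₁ a₂ b Set.univ
    simp only [Set.univ_inter] at e
    rw [Set.inter_comm D, Set.inter_comm D, hD]
    linarith
  have hfin : μ.real (openConn a₁ b ∩ Q) - μ.real (openConn a₂ b ∩ Q) =
      μ.real (D ∩ (openConn a₁ b ∩ Q)) - μ.real (D ∩ (openConn a₂ b ∩ Q)) := by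
    have e := real_inter_openConn_sub_eq μ a₁ a₂ b Q
    have s1 : Q ∩ openConn a₁ b = openConn a₁ b ∩ Q := Set.inter_comm _ _
    have s2 : Q ∩ openConn a₂ b = openConn a₂ b ∩ Q := Set.inter_comm _ _
    have s3 : Q ∩ openConn a₁ b ∩ (openConn a₁ a₂)ᶜ = D ∩ (openConn a₁ b ∩ Q) := by
      ext ω; simp only [hD, Set.mem_inter_iff, Set.mem_compl_iff]; tauto
    have s4 : Q ∩ openConn a₂ b ∩ (openConn a₁ a₂)ᶜ = D ∩ (openConn a₂ b ∩ Q) := by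
      ext ω; simp only [hD, Set.mem_inter_iff, Set.mem_compl_iff]; tauto
    rw [s3, s4, s1, s2] at e
    exact e
  have hQD : Q ∩ (openConn a₁ a₂ : Set (BondConfig V))ᶜ = D ∩ Q := by rw [hD, Set.inter_comm]
  rw [hQD]
  -- combine the two association inequalities linearly
  nlinarith [hI, hJ, hτ', hfin, measureReal_nonneg (μ := μ) (s := D), measureReal_nonneg (μ := μ) (s := D ∩ Q)]

end SandwichSet

section GapCertificate
open Set
open scoped BigOperators Classical

variable {n : ℕ}

/-- **Gap certificate for SIMEX (un-glued form).**  See the module docstring. [cite: KozmaNitzan2024, Lemma 3 (pp. 6–7)] -/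
theorem simexU_of_gapCertificate (u : Sym2 (Fin n) → unitInterval) (A S : Finset (Fin n)) (b a₀ c : Fin n)
    (hc : c ∈ (A.erase b).erase a₀) (hD : 0 < (prodBernoulli u).real (openConn a₀ c : Set (BondConfig (Fin n)))ᶜ)
    (hgap : ((prodBernoulli u).real
              ((openConn c b : Set (BondConfig (Fin n)))
                ∩ ((⋃ v ∈ S, ⋃ a ∈ (A.erase b).erase a₀, (openConn v a : Set (BondConfig (Fin n)))) ∩ ⋂ v ∈ S, (openConn v a₀)ᶜ)
                ∩ ⋂ v ∈ S, (openConn v c)ᶜ)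
            - (prodBernoulli u).real
              ((⋃ v ∈ S, (openConn v b : Set (BondConfig (Fin n))))
                ∩ ((⋃ v ∈ S, ⋃ a ∈ (A.erase b).erase a₀, (openConn v a : Set (BondConfig (Fin n)))) ∩ ⋂ v ∈ S, (openConn v a₀)ᶜ)
                ∩ ⋂ v ∈ S, (openConn v c)ᶜ))
            * (prodBernoulli u).real (openConn a₀ c : Set (BondConfig (Fin n)))ᶜ
          ≤ ((prodBernoulli u).real (openConn c b) - (prodBernoulli u).real (openConn a₀ b))
            * (prodBernoulli u).real
              ((((⋃ v ∈ S, ⋃ a ∈ (A.erase b).erase a₀, (openConn v a : Set (BondConfig (Fin n)))) ∩ ⋂ v ∈ S, (openConn v a₀)ᶜ))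
                ∩ (openConn a₀ c)ᶜ)) :
    (prodBernoulli u).real
        ((openConn a₀ b : Set (BondConfig (Fin n)))
          ∩ ((⋃ v ∈ S, ⋃ a ∈ (A.erase b).erase a₀, (openConn v a : Set (BondConfig (Fin n)))) ∩ ⋂ v ∈ S, (openConn v a₀)ᶜ))
      ≤ (prodBernoulli u).real
        ((⋃ v ∈ S, (openConn v b : Set (BondConfig (Fin n))))
          ∩ ((⋃ v ∈ S, ⋃ a ∈ (A.erase b).erase a₀, (openConn v a : Set (BondConfig (Fin n)))) ∩ ⋂ v ∈ S, (openConn v a₀)ᶜ)) := by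
  set μ := prodBernoulli u with hμ
  set CAP : Set (BondConfig (Fin n)) :=
    (⋃ v ∈ S, ⋃ a ∈ (A.erase b).erase a₀, (openConn v a : Set (BondConfig (Fin n)))) ∩ ⋂ v ∈ S, (openConn v a₀)ᶜ with hCAP
  set SC : Set (BondConfig (Fin n)) := ⋃ v ∈ S, (openConn v c : Set (BondConfig (Fin n))) with hSC
  set SB : Set (BondConfig (Fin n)) := ⋃ v ∈ S, (openConn v b : Set (BondConfig (Fin n))) with hSB
  set D : Set (BondConfig (Fin n)) := (openConn a₀ c : Set (BondConfig (Fin n)))ᶜ with hDdef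
  have hms : ∀ s : Set (BondConfig (Fin n)), MeasurableSet s := fun s => (Set.toFinite s).measurableSet
  set 𝓕 : Set (Set (Fin n)) := {T | (∃ a ∈ (A.erase b).erase a₀, a ∈ T) ∧ a₀ ∉ T} with h𝓕
  have hQ : {ω : BondConfig (Fin n) | (⋃ o ∈ S, openCluster ω o) ∈ 𝓕} = CAP := by
    ext ω
    simp only [h𝓕, hCAP, Set.mem_setOf_eq, Set.mem_inter_iff, Set.mem_iUnion, Set.mem_iInter, Set.mem_compl_iff,
      exists_prop]
    constructor
    · rintro ⟨⟨a, ha, v, hv, hva⟩, hna⟩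
      exact ⟨⟨v, hv, a, ha, hva⟩, fun v hv hva => hna ⟨v, hv, hva⟩⟩
    · rintro ⟨⟨v, hv, a, ha, hva⟩, hna⟩
      exact ⟨⟨a, ha, v, hv, hva⟩, fun ⟨v, hv, hva⟩ => hna v hv hva⟩
  have hlo : ∀ ω : BondConfig (Fin n), c ∈ (⋃ o ∈ S, openCluster ω o) → a₀ ∉ (⋃ o ∈ S, openCluster ω o) →
      (⋃ o ∈ S, openCluster ω o) ∈ 𝓕 := fun ω h1 h2 => ⟨⟨c, hc, h1⟩, h2⟩
  have hhi : ∀ ω : BondConfig (Fin n), (⋃ o ∈ S, openCluster ω o) ∈ 𝓕 → a₀ ∉ (⋃ o ∈ S, openCluster ω o) :=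
    fun ω h => h.2
  have hsand := SandwichSet.lemma3_sandwich_set_gap u a₀ c b S 𝓕 hlo hhi
  rw [hQ] at hsand
  -- split `{c ↔ b} ∩ CAP` and `SB ∩ CAP` along `c ∈ K_S`
  have hsplit : μ.real ((openConn c b : Set (BondConfig (Fin n))) ∩ CAP) =
      μ.real ((openConn c b : Set (BondConfig (Fin n))) ∩ CAP ∩ SC) + μ.real (((openConn c b : Set (BondConfig (Fin n))) ∩ CAP) \ SC) :=
    (measureReal_inter_add_sdiff (hms SC) (measure_ne_top _ _)).symm
  have hsplitB : μ.real (SB ∩ CAP) = μ.real (SB ∩ CAP ∩ SC) + μ.real ((SB ∩ CAP) \ SC) :=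
    (measureReal_inter_add_sdiff (hms SC) (measure_ne_top _ _)).symm
  have h1 : (openConn c b : Set (BondConfig (Fin n))) ∩ CAP ∩ SC ⊆ SB ∩ CAP ∩ SC := by
    rintro ω ⟨⟨hcb, hcap⟩, hSc⟩
    refine ⟨⟨?_, hcap⟩, hSc⟩
    simp only [hSC, Set.mem_iUnion, exists_prop] at hSc
    obtain ⟨v, hv, hvc⟩ := hSc
    simp only [hSB, Set.mem_iUnion, exists_prop]
    exact ⟨v, hv, blockGrowth_openConn_trans hvc hcb⟩
  have hdiff : ∀ X : Set (BondConfig (Fin n)), X \ SC = X ∩ ⋂ v ∈ S, (openConn v c : Set (BondConfig (Fin n)))ᶜ := by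
    intro X; ext ω
    simp only [hSC, Set.mem_sdiff, Set.mem_inter_iff, Set.mem_iUnion, Set.mem_iInter, Set.mem_compl_iff, exists_prop,
      not_exists, not_and]
  have e1 : μ.real ((openConn c b : Set (BondConfig (Fin n))) ∩ CAP ∩ SC) ≤ μ.real (SB ∩ CAP ∩ SC) :=
    measureReal_mono h1 (measure_ne_top _ _)
  have hgap' : (μ.real (((openConn c b : Set (BondConfig (Fin n))) ∩ CAP) \ SC) - μ.real ((SB ∩ CAP) \ SC)) * μ.real D
      ≤ (μ.real (openConn c b : Set (BondConfig (Fin n))) - μ.real (openConn a₀ b : Set (BondConfig (Fin n))))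
          * μ.real (CAP ∩ D) := by
    rw [hdiff, hdiff]; exact hgap
  have hDn : 0 ≤ μ.real D := measureReal_nonneg
  -- `μ D · (goal difference) ≤ 0`
  have hkey : μ.real D * (μ.real ((openConn a₀ b : Set (BondConfig (Fin n))) ∩ CAP) - μ.real (SB ∩ CAP)) ≤ 0 := by
    nlinarith [hsand, hgap', hsplit, hsplitB, e1, hDn]
  by_contra hneg
  push Not at hneg
  have : 0 < μ.real D * (μ.real ((openConn a₀ b : Set (BondConfig (Fin n))) ∩ CAP) - μ.real (SB ∩ CAP)) :=
    mul_pos hD (by linarith)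
  linarith

/-- **Gap certificate, glued form** (an instance of `stub_simex`). [cite: KozmaNitzan2024, Lemma 3 (pp. 6–7)] -/
theorem simex_of_gapCertificate (u : Sym2 (Fin n) → unitInterval) (A S : Finset (Fin n)) (b a₀ c : Fin n)
    (hc : c ∈ (A.erase b).erase a₀) (hD : 0 < (prodBernoulli u).real (openConn a₀ c : Set (BondConfig (Fin n)))ᶜ)
    (hgap : ((prodBernoulli u).real
              ((openConn c b : Set (BondConfig (Fin n)))
                ∩ ((⋃ v ∈ S, ⋃ a ∈ (A.erase b).erase a₀, (openConn v a : Set (BondConfig (Fin n)))) ∩ ⋂ v ∈ S, (openConn v a₀)ᶜ)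
                ∩ ⋂ v ∈ S, (openConn v c)ᶜ)
            - (prodBernoulli u).real
              ((⋃ v ∈ S, (openConn v b : Set (BondConfig (Fin n))))
                ∩ ((⋃ v ∈ S, ⋃ a ∈ (A.erase b).erase a₀, (openConn v a : Set (BondConfig (Fin n)))) ∩ ⋂ v ∈ S, (openConn v a₀)ᶜ)
                ∩ ⋂ v ∈ S, (openConn v c)ᶜ))
            * (prodBernoulli u).real (openConn a₀ c : Set (BondConfig (Fin n)))ᶜ
          ≤ ((prodBernoulli u).real (openConn c b) - (prodBernoulli u).real (openConn a₀ b))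
            * (prodBernoulli u).real
              ((((⋃ v ∈ S, ⋃ a ∈ (A.erase b).erase a₀, (openConn v a : Set (BondConfig (Fin n)))) ∩ ⋂ v ∈ S, (openConn v a₀)ᶜ))
                ∩ (openConn a₀ c)ᶜ)) :
    (prodBernoulli (fun e : Sym2 (Fin n) => if (∀ y ∈ e, y ∈ S) ∧ ¬ e.IsDiag then 1 else u e)).real
        ((⋃ v ∈ S, ⋃ a ∈ (A.erase b).erase a₀, openConn v a) ∩ openConn a₀ b ∩ ⋂ v ∈ S, (openConn v a₀)ᶜ)
      ≤ (prodBernoulli (fun e : Sym2 (Fin n) => if (∀ y ∈ e, y ∈ S) ∧ ¬ e.IsDiag then 1 else u e)).real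
        ((⋃ v ∈ S, openConn v b) ∩ (⋃ v ∈ S, ⋃ a ∈ (A.erase b).erase a₀, openConn v a)
          ∩ ⋂ v ∈ S, (openConn v a₀)ᶜ) := by
  rw [simex_glue_lhs, simex_glue_rhs]
  exact simexU_of_gapCertificate u A S b a₀ c hc hD hgap

/-- **The D-cone instance from the gap certificate** (any number of relays). [cite: KozmaNitzan2024, (41) p. 36, Lemma 3 (pp. 6–7)] -/
theorem dKernel_of_gapCertificate (u : Sym2 (Fin n) → unitInterval) (A S : Finset (Fin n)) (b a₀ c : Fin n)
    (hb : b ∈ A) (hc : c ∈ (A.erase b).erase a₀) (hD : 0 < (prodBernoulli u).real (openConn a₀ c : Set (BondConfig (Fin n)))ᶜ)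
    (hgap : ((prodBernoulli u).real
              ((openConn c b : Set (BondConfig (Fin n)))
                ∩ ((⋃ v ∈ S, ⋃ a ∈ (A.erase b).erase a₀, (openConn v a : Set (BondConfig (Fin n)))) ∩ ⋂ v ∈ S, (openConn v a₀)ᶜ)
                ∩ ⋂ v ∈ S, (openConn v c)ᶜ)
            - (prodBernoulli u).real
              ((⋃ v ∈ S, (openConn v b : Set (BondConfig (Fin n))))
                ∩ ((⋃ v ∈ S, ⋃ a ∈ (A.erase b).erase a₀, (openConn v a : Set (BondConfig (Fin n)))) ∩ ⋂ v ∈ S, (openConn v a₀)ᶜ)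
                ∩ ⋂ v ∈ S, (openConn v c)ᶜ))
            * (prodBernoulli u).real (openConn a₀ c : Set (BondConfig (Fin n)))ᶜ
          ≤ ((prodBernoulli u).real (openConn c b) - (prodBernoulli u).real (openConn a₀ b))
            * (prodBernoulli u).real
              ((((⋃ v ∈ S, ⋃ a ∈ (A.erase b).erase a₀, (openConn v a : Set (BondConfig (Fin n)))) ∩ ⋂ v ∈ S, (openConn v a₀)ᶜ))
                ∩ (openConn a₀ c)ᶜ)) :
    (prodBernoulli (fun e : Sym2 (Fin n) => if (∀ y ∈ e, y ∈ S) ∧ ¬ e.IsDiag then 1 else u e)).real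
        ((⋃ v ∈ S, ⋃ a ∈ A, (openConn v a : Set (BondConfig (Fin n)))) ∩ openConn a₀ b)
      ≤ (prodBernoulli (fun e : Sym2 (Fin n) => if (∀ y ∈ e, y ∈ S) ∧ ¬ e.IsDiag then 1 else u e)).real
        (⋃ v ∈ S, (openConn v b : Set (BondConfig (Fin n)))) :=
  dKernel_of_simex_instance _ A S b a₀ hb (simex_of_gapCertificate u A S b a₀ c hc hD hgap)

end GapCertificate

end Summit.CriticalPhenomena.PercolationContinuityZ3.Theorems

end
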